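import Literature.Geometry.Lorentzian.KerrNullRadialPotential
import Literature.Geometry.Lorentzian.KerrPhotonOrbit
import Literature.Geometry.Lorentzian.SpacetimeLocalConvergence
import Literature.Geometry.Lorentzian.CoordScalarCurvatureEvolution
import Literature.Geometry.Lorentzian.KerrSchildCoord
import Literature.Geometry.Lorentzian.SpacetimeMetricInCoordsCalculus
import Literature.Geometry.Lorentzian.CoordScalarJet
import Summits.FinalStateConjecture.FinalStateConjecture.Theorems.BartnikGapSettlingGapExhaustionCylindersBendInwardOf
import Summits.FinalStateConjecture.FinalStateConjecture.Theorems.BartnikGapSettlingGapExhaustionCylindersExactMargin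
import Summits.FinalStateConjecture.FinalStateConjecture.Theorems.BartnikGapSettlingGapExhaustionMultiplierFormStable
import HarnessLib

/-!
# `KerrMultiplierBelowShell`: the unconditional time-uniform multiplier form below the photon shell
(crux `GapExhaustion`, stmt-FinalStateConjecture-10808, line photon-shell-pseudoconvexity;
stub (U-in) `stub_kerrMultiplierBelowShell` of the quantitative pseudo-convexity bricks,
Ionescu–Klainerman, JAMS 26 (2013), Lemma 2.11 (a), multiplier form of the strong
pseudo-convexity of the cylinders `{r = c}`, `r₊ < c < r_ph⁺`, for the defining function
`f = r − c` — the input of their Killing-extension theorem used by the line's outward sweep S5)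

From

* (B) the landed exact-Kerr margin `stub_kerrCylindersExactMargin`: on a radial band
  `r₊ < r_lo ≤ r ≤ r_e < r_ph⁺ = Kerr.photonOrbitRadius M (−|a|)` of the Kerr–Schild chart the
  coordinate Hessian of the Kerr–Schild radius `r` with respect to the Kerr–Schild components
  `g_{M,a}` is `≤ −m‖w‖²` on null vectors tangent to the cylinders `{r = c}`, at all times `x⁰`
  (NO orthogonality constraint), and
* (P-1) the landed generic passage `stub_multiplierFormStable` from a constrained margin over a
  compact set to the uniform multiplier form (po3) — a multiplier `μ`, `|μ| ≤ ε₁⁻¹`, with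
  `ε₁²‖w‖² ≤ μ G(w,w) − Hess f(w,w) + ε₁⁻² (G(e',w)² + df(w)²)` for ALL `w` — stable under a
  `δ`-perturbation of the `1`-jet of the components at the point and of the conditioning vector
  `e ↦ e'`, used here with the trivial conditioning vector `e = e' = 0` (so that the extra
  constraint `G₀ x 0 w = 0` is automatic and the extra penalty `G x 0 w ^ 2` vanishes),

we deduce the time-uniform multiplier form for every spacetime chart on the exterior region
`{M < r}` whose pulled-back components (`Spacetime.metricInCoords`) are `δ`-close in `C²` sup norm
(`supCkENorm`) to `g_{M,a}` on the band: apply (P-1) on the compact time slice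
`{x⁰ = 0, r_lo ≤ r ≤ r_e}` (`kerrCylindersBendInward_isCompact_slice`) with `G₀ = g_{M,a}`,
`f = r`, `e = 0`, margin `m`, and transport to arbitrary times by the stationarity of Kerr
(`Kerr.bilin_add_smul_basisVector_zero`, `Kerr.radius_add_time_smul_basisVector`) and the
naturality of the coordinate Hessian under translations
(`kerrCylindersBendInward_hessAt_comp_add_right`, `fderiv_comp_add_right`). The proof is that of
the `T`-conditional twin (P-2) `stub_kerrConditionalMultiplier_of` with `T := 0`.
-/

noncomputable section

-- instance search through the nested operator types `E4 →L[ℝ] E4 →L[ℝ] E4 →L[ℝ] ℝ`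
set_option maxSynthPendingDepth 3

-- D-0017: single-problem summit, `Summit.<S>.<S>.…` by design (cf. lakefile `weak.linter.dupNamespace`).
set_option linter.dupNamespace false

namespace Summit.FinalStateConjecture.FinalStateConjecture.Theorems

open Set Literature.Geometry.Lorentzian Literature.Geometry.Lorentzian.MetricCoord
open scoped Manifold ContDiff Topology ENNReal

/-- **(U-in) The unconditional time-uniform multiplier form (Ionescu–Klainerman, JAMS 26 (2013),
Lemma 2.11 (a)) on every Kerr band below the photon shell.** From the exact-Kerr Hessian margin
`−m` on the band `r₊ < r_lo ≤ r ≤ r_e < r_ph⁺` (`stub_kerrCylindersExactMargin`) and the generic,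
`C¹`-stable passage from a constrained Hessian margin over a compact set to the uniform multiplier
form (`stub_multiplierFormStable`, conditioning vector `e = 0`), applied on the compact time slice
`{x⁰ = 0, r_lo ≤ r ≤ r_e}` with `G₀ = g_{M,a}`, `f = r`: for every spacetime chart `Φ` on the
exterior region `{M < r}` whose pulled-back components are `δ`-close to `g_{M,a}` in `C²` sup
norm on the band, at every band point `z` and every time there is a multiplier `μ`,
`|μ| ≤ ε₁⁻¹`, with `ε₁²‖w‖² ≤ μ (Φ^* g)_z(w,w) − Hess r_z(w,w) + ε₁⁻² dr_z(w)²` for all `w` — a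
band point `z` at time `t = z⁰` is translated to the slice (`z = z' + t ∂₀`), the components are
translated along (`y ↦ (Φ^* g)(y + t ∂₀)`), and Kerr is stationary, so the `1`-jets at `z'` of
the translated components relative to `g_{M,a}` are those at `z`, bounded by the sup norm, while
the Hessian is natural under translations. -/
theorem stub_kerrMultiplierBelowShell :
    ∀ (M a r_lo r_e : ℝ), 0 < M → |a| < M → Kerr.rPlus M a < r_lo → r_lo < r_e →
      r_e < Kerr.photonOrbitRadius M (-|a|) →
      ∃ (δ ε₁ : ℝ), 0 < δ ∧ 0 < ε₁ ∧
      ∀ (𝓢 : Spacetime.{0} 4) (Φ : E4 → 𝓢.carrier),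
        ContMDiffOn 𝓘(ℝ, E4) (𝓡 4) ∞ Φ {z | M < Kerr.radius a z} →
        Topology.IsOpenEmbedding ({z : E4 | M < Kerr.radius a z}.restrict Φ) →
        supCkENorm {z | M < Kerr.radius a z ∧ r_lo ≤ Kerr.radius a z ∧ Kerr.radius a z ≤ r_e} 2
            (fun z => 𝓢.metricInCoords Φ z - Kerr.bilin M a z) ≤ ENNReal.ofReal δ →
        ∀ z : E4, r_lo ≤ Kerr.radius a z → Kerr.radius a z ≤ r_e →
          ∃ μ : ℝ, |μ| ≤ ε₁⁻¹ ∧ ∀ w : E4,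
            ε₁ ^ 2 * ‖w‖ ^ 2 ≤ μ * 𝓢.metricInCoords Φ z w w
              - hessAt (𝓢.metricInCoords Φ) (Kerr.radius a) z w w
              + ε₁⁻¹ ^ 2 * (fderiv ℝ (Kerr.radius a) z w) ^ 2 := by
  intro M a r_lo r_e hM ha hlo hloe he
  obtain ⟨m, hm, hmargin⟩ := stub_kerrCylindersExactMargin M a r_lo r_e hM ha hlo hloe he
  -- the radius is positive on the band: `r ≥ r_lo > r₊ ≥ M > 0`
  have hrPlus : M ≤ Kerr.rPlus M a := le_add_of_nonneg_right (Real.sqrt_nonneg _)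
  have hMlo : M < r_lo := hrPlus.trans_lt hlo
  have hlo0 : 0 < r_lo := hM.trans hMlo
  -- the compact time slice of the band, inside the open set `{r > 0}`
  set S : Set E4 := {z | z 0 = 0 ∧ r_lo ≤ Kerr.radius a z ∧ Kerr.radius a z ≤ r_e} with hSdef
  have hS : IsCompact S := kerrCylindersBendInward_isCompact_slice a r_e hlo0
  have hSpos : ∀ z ∈ S, 0 < Kerr.radius a z := fun z hz ↦ hlo0.trans_le hz.2.1
  have hU : ∃ U : Set E4, IsOpen U ∧ S ⊆ U ∧ ContDiffOn ℝ 1 (Kerr.bilin M a) U ∧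
      ContDiffOn ℝ 2 (Kerr.radius a) U :=
    ⟨{z | 0 < Kerr.radius a z}, isOpen_lt continuous_const (Kerr.continuous_radius a), hSpos,
      fun z hz ↦ (Kerr.contDiffAt_bilin M a hz).contDiffWithinAt,
      fun z hz ↦ (Kerr.contDiffAt_radius hz).contDiffWithinAt⟩
  have hinv : ∀ z ∈ S, (Kerr.bilin M a z).IsInvertible := fun z hz ↦
    isInvertible_of_nondegenerate fun v hv ↦ Kerr.bilin_nondegenerate M a (hSpos z hz) v hv
  -- the margin of (B), with the (void) conditioning constraint `g_{M,a}(0, w) = 0` ignored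
  have hmarginS : ∀ z ∈ S, ∀ w : E4, Kerr.bilin M a z w w = 0 →
      fderiv ℝ (Kerr.radius a) z w = 0 → Kerr.bilin M a z (0 : E4) w = 0 →
      hessAt (Kerr.bilin M a) (Kerr.radius a) z w w ≤ -m * ‖w‖ ^ 2 :=
    fun z hz w hnull hdr _ ↦ hmargin z w hz.2.1 hz.2.2 hnull hdr
  obtain ⟨δ, ε₁, hδ, hε₁, hstab⟩ :=
    stub_multiplierFormStable (Kerr.bilin M a) (Kerr.radius a) (0 : E4) S m hS hm hU hinv hmarginS
  refine ⟨δ, ε₁, hδ, hε₁, ?_⟩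
  intro 𝓢 Φ hΦ _ hsup z hzlo hze
  -- smoothness of the pulled-back components on the open exterior region, and of `g_{M,a}`
  have hO : IsOpen {z : E4 | M < Kerr.radius a z} :=
    isOpen_lt continuous_const (Kerr.continuous_radius a)
  have hz : z ∈ {z : E4 | M < Kerr.radius a z} := hMlo.trans_le hzlo
  have hGdiff : DifferentiableAt ℝ (𝓢.metricInCoords Φ) z :=
    (((𝓢.contDiffOn_metricInCoords hO hΦ) z hz).contDiffAt (hO.mem_nhds hz)).differentiableAt
      (by simp)
  have hzpos : 0 < Kerr.radius a z := hlo0.trans_le hzlo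
  have hKdiff : DifferentiableAt ℝ (Kerr.bilin M a) z :=
    (Kerr.contDiffAt_bilin M a hzpos (n := 1)).differentiableAt one_ne_zero
  -- pointwise `C¹`-closeness at `z` from the `C²` sup norm over the band
  have hzK : z ∈ {z : E4 | M < Kerr.radius a z ∧
      r_lo ≤ Kerr.radius a z ∧ Kerr.radius a z ≤ r_e} := ⟨hz, hzlo, hze⟩
  have hjet : ∀ k ≤ 2,
      ‖iteratedFDeriv ℝ k (fun z ↦ 𝓢.metricInCoords Φ z - Kerr.bilin M a z) z‖ ≤ δ := by
    intro k hk
    have h := (enorm_iteratedFDeriv_le_supCkENorm hk hzK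
      (fun z ↦ 𝓢.metricInCoords Φ z - Kerr.bilin M a z)).trans hsup
    rwa [← ofReal_norm, ENNReal.ofReal_le_ofReal_iff hδ.le] at h
  have hd0 : ‖𝓢.metricInCoords Φ z - Kerr.bilin M a z‖ ≤ δ := by
    have h := hjet 0 (by norm_num)
    rwa [norm_iteratedFDeriv_zero] at h
  have hd1 : ‖fderiv ℝ (𝓢.metricInCoords Φ) z - fderiv ℝ (Kerr.bilin M a) z‖ ≤ δ := by
    have h := hjet 1 (by norm_num)
    rwa [norm_iteratedFDeriv_one, fderiv_fun_sub hGdiff hKdiff] at h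
  -- translate `z` to the time slice: `z = z' + t ∂₀`, `t = z⁰`
  obtain ⟨t, ht⟩ : ∃ t : ℝ, z 0 = t := ⟨_, rfl⟩
  obtain ⟨z', hz'z⟩ : ∃ z' : E4, z' + t • E4.basisVector 0 = z :=
    ⟨z - t • E4.basisVector 0, sub_add_cancel z _⟩
  have hz'0 : z' 0 = 0 := by
    have h : (z' + t • E4.basisVector 0) 0 = z 0 := by rw [hz'z]
    rw [ht] at h
    simpa [E4.basisVector] using h
  -- stationarity of Kerr: the radius, the components and their first derivatives agree
  have hradfun : (fun y : E4 ↦ Kerr.radius a (y + t • E4.basisVector 0)) = Kerr.radius a :=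
    funext fun y ↦ Kerr.radius_add_time_smul_basisVector a y t
  have hbilfun : (fun y : E4 ↦ Kerr.bilin M a (y + t • E4.basisVector 0)) = Kerr.bilin M a :=
    funext fun y ↦ Kerr.bilin_add_smul_basisVector_zero M a y t
  have hrad' : Kerr.radius a z' = Kerr.radius a z := by
    rw [← hz'z, Kerr.radius_add_time_smul_basisVector]
  have hbil' : Kerr.bilin M a z' = Kerr.bilin M a z := by
    rw [← hz'z, Kerr.bilin_add_smul_basisVector_zero]
  have hfdrad' : fderiv ℝ (Kerr.radius a) z' = fderiv ℝ (Kerr.radius a) z := by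
    rw [← hz'z, ← fderiv_comp_add_right (t • E4.basisVector 0)]
    exact (congrArg (fun g : E4 → ℝ ↦ fderiv ℝ g z') hradfun).symm
  have hfdbil' : fderiv ℝ (Kerr.bilin M a) z' = fderiv ℝ (Kerr.bilin M a) z := by
    rw [← hz'z, ← fderiv_comp_add_right (t • E4.basisVector 0)]
    exact (congrArg (fun g : E4 → E4 →L[ℝ] E4 →L[ℝ] ℝ ↦ fderiv ℝ g z') hbilfun).symm
  have hz'S : z' ∈ S := by
    rw [hSdef]
    exact ⟨hz'0, hzlo.trans_eq hrad'.symm, hrad'.trans_le hze⟩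
  -- the translated components `y ↦ (Φ^* g)(y + t ∂₀)` and the naturality of the Hessian
  have hGt1 : fderiv ℝ (fun y ↦ 𝓢.metricInCoords Φ (y + t • E4.basisVector 0)) z' =
      fderiv ℝ (𝓢.metricInCoords Φ) z := by
    rw [fderiv_comp_add_right, hz'z]
  have hH : hessAt (fun y ↦ 𝓢.metricInCoords Φ (y + t • E4.basisVector 0)) (Kerr.radius a) z' =
      hessAt (𝓢.metricInCoords Φ) (Kerr.radius a) z := by
    have h := kerrCylindersBendInward_hessAt_comp_add_right (𝓢.metricInCoords Φ) (Kerr.radius a)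
      (t • E4.basisVector 0) z'
    rw [hradfun, hz'z] at h
    exact h
  -- (P-1) at `x = z'`, `G =` the translated components, `e' = 0`
  obtain ⟨μ, hμ, hall⟩ := hstab z' hz'S (fun y ↦ 𝓢.metricInCoords Φ (y + t • E4.basisVector 0))
    (0 : E4)
    (by
      show ‖𝓢.metricInCoords Φ (z' + t • E4.basisVector 0) - Kerr.bilin M a z'‖ ≤ δ
      rw [hz'z, hbil']
      exact hd0)
    (by
      rw [hGt1, hfdbil']
      exact hd1)
    (by
      rw [sub_zero, norm_zero]
      exact hδ.le)
  refine ⟨μ, hμ, fun w ↦ ?_⟩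
  -- the multiplier form at `z'` for the translated data is the one at `z`; the penalty
  -- `(Φ^* g)(0, w)²` of the trivial conditioning vector vanishes
  have key : ε₁ ^ 2 * ‖w‖ ^ 2 ≤ μ * 𝓢.metricInCoords Φ (z' + t • E4.basisVector 0) w w
      - hessAt (fun y ↦ 𝓢.metricInCoords Φ (y + t • E4.basisVector 0)) (Kerr.radius a) z' w w
      + ε₁⁻¹ ^ 2 * ((𝓢.metricInCoords Φ (z' + t • E4.basisVector 0) (0 : E4) w) ^ 2
        + (fderiv ℝ (Kerr.radius a) z' w) ^ 2) := hall w
  rw [map_zero, zero_apply, zero_pow two_ne_zero, zero_add, hH, hfdrad', hz'z] at key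
  exact key

end Summit.FinalStateConjecture.FinalStateConjecture.Theorems

end
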